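import Mathlib
import Literature.MathematicalPhysics.MHD.SolovevSolutions
import Literature.MathematicalPhysics.MHD.FluxSurfaceGeometry
import HarnessLib

/-!
# Second-order field quantities of the Pataki–Cerfon–Freidberg Solov'ev solution: `Ψ_RZ`, `|∇Ψ|²` and its
# gradient, `B²` and its gradient, and the normal curvature `κ_n` (12.39) in closed form (proved)

For the PCF benchmark solution `Ψ = R⁴/8 + d₁ + d₂R² + d₃(R⁴ − 4R²Z²)` of `Δ*Ψ = R²` (Pataki–Cerfon–Freidberg
2013 §6.1 — bib `PatakiCerfonFreidberg2013`; `Solovev.psiPCF`, first/second pure derivatives in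
`SolovevSolutions.lean`, third-order jets in `SolovevNearAxis.lean`) this file PROVES the remaining
second-order objects that the Mercier integrands of Freidberg, *Ideal MHD* (2014) §12.5.3 (12.84) consume
through the normal curvature `κ_n = (μ₀RB_p/B²)∂_ψ(p + B²/2μ₀)` (12.39) (typed in `FluxSurfaceGeometry.lean`
as `FluxGeometry.normalCurvature`, with `∂_ψ f = ∇ψ·∇f/|∇ψ|²` = `FluxGeometry.dPsi`):

* `hasDerivAt_psiPCF_R/Z` — differentiability of `Ψ` in each slot with the typed `Ψ_R`, `Ψ_Z`;
* `dRZ_psiPCF`, `dZR_psiPCF` — the MIXED second derivative `Ψ_RZ = Ψ_ZR = −16 d₃ R Z`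
  (vocabulary `FluxGeometry.dRZ/dZR`);
* `gradSq_psiPCF` — `|∇Ψ|²` as an explicit polynomial; `dR_gradSq_psiPCF`, `dZ_gradSq_psiPCF` — its gradient
  `∂_R|∇Ψ|² = 2Ψ_RΨ_RR + 2Ψ_ZΨ_ZR`, `∂_Z|∇Ψ|² = 2Ψ_RΨ_RZ + 2Ψ_ZΨ_ZZ` (with the `HasDerivAt` forms);
* `dR_fieldBsq_psiPCF`, `dZ_fieldBsq_psiPCF` — for the CONSTANT free function `F` of the Solov'ev profile
  (`FF′ = 0`), `B² = (F² + |∇Ψ|²)/R²` (`FluxGeometry.fieldBsq_const`) has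
  `∂_RB² = ∂_R|∇Ψ|²/R² − 2(F² + |∇Ψ|²)/R³`, `∂_ZB² = ∂_Z|∇Ψ|²/R²` (`R ≠ 0`);
* **`normalCurvature_psiPCF`** — with the PCF pressure `p(s) = p₀ − s/μ₀` (`μ₀p′ = −1`) and constant `F`,
  at any point with `R ≠ 0`, `∇Ψ ≠ 0`:
  `κ_n = (R B_p/B²)·(−1 + (Ψ_R ∂_RB² + Ψ_Z ∂_ZB²)/(2|∇Ψ|²))` — `μ₀` drops out, and every factor is an
  explicit rational function of `(R, Z)` and `|∇Ψ| = R B_p` by the lemmas above.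

So the integrand `RB_pκ_n` of Mercier's `I(RB_pκ_n)` (12.84) is ALGEBRAIC along any parametrised flux surface
of the PCF equilibrium (e.g. along `Solovev.lcLoop` or the cell's four-arc edge loops), which is what a
certified quadrature needs. NOT here: the local-shear term `∂Q/∂ψ` of `Γ` (needs a `(ψ, l)` chart —
pub/gridfusion/models/F2-SCOPING.md R3), the geodesic curvature, and any stability statement.
HONEST FRAMING: exact calculus about a MODEL equilibrium (ideal MHD, Solov'ev profiles); nothing here says any
configuration is stable. Typer/prover: gridfusion-model-5 (g2), 2026-08-27.
-/

noncomputable section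

namespace Literature.MathematicalPhysics.MHD.Solovev

open GradShafranov FluxGeometry _root_.Real

/-! ## Calculus helpers -/

/-- Derivative of `a + b x²`. [folklore] -/
private theorem so_hasDerivAt_quad (a b x : ℝ) :
    HasDerivAt (fun x => a + b * x ^ 2) (2 * b * x) x := by
  have h := (hasDerivAt_const x a).fun_add ((hasDerivAt_pow 2 x).const_mul b)
  exact h.congr_deriv (by norm_num; ring)

/-- Derivative of `a x + b x³`. [folklore] -/
private theorem so_hasDerivAt_cubic (a b x : ℝ) :
    HasDerivAt (fun x => a * x + b * x ^ 3) (a + 3 * b * x ^ 2) x := by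
  have h := ((hasDerivAt_id' x).const_mul a).fun_add ((hasDerivAt_pow 3 x).const_mul b)
  exact h.congr_deriv (by norm_num; ring)

/-- `r ↦ Ψ(r, Z)` is differentiable with derivative `Ψ_R` (PCF solution). [cite: PatakiCerfonFreidberg2013, §6.1] -/
theorem hasDerivAt_psiPCF_R (d₁ d₂ d₃ R Z : ℝ) :
    HasDerivAt (fun r => psiPCF d₁ d₂ d₃ r Z) (dR (psiPCF d₁ d₂ d₃) R Z) R := by
  rw [dR_psiPCF]
  have h := (((hasDerivAt_pow 4 R).div_const 8).fun_add (hasDerivAt_const R d₁)).fun_add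
    (((hasDerivAt_pow 2 R).const_mul d₂).fun_add
      (((hasDerivAt_pow 4 R).fun_sub (((hasDerivAt_pow 2 R).mul_const (Z ^ 2)).const_mul 4)).const_mul d₃))
  have e : (fun r => psiPCF d₁ d₂ d₃ r Z)
      = fun r => r ^ 4 / 8 + d₁ + (d₂ * r ^ 2 + d₃ * (r ^ 4 - 4 * (r ^ 2 * Z ^ 2))) := by
    funext r; unfold psiPCF; ring
  rw [e]
  exact h.congr_deriv (by norm_num; ring)

/-- `z ↦ Ψ(R, z)` is differentiable with derivative `Ψ_Z` (PCF solution). [cite: PatakiCerfonFreidberg2013, §6.1] -/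
theorem hasDerivAt_psiPCF_Z (d₁ d₂ d₃ R Z : ℝ) :
    HasDerivAt (fun z => psiPCF d₁ d₂ d₃ R z) (dZ (psiPCF d₁ d₂ d₃) R Z) Z := by
  rw [dZ_psiPCF]
  have e : (fun z => psiPCF d₁ d₂ d₃ R z)
      = fun z => (R ^ 4 / 8 + d₁ + d₂ * R ^ 2 + d₃ * R ^ 4) + (-(4 * d₃ * R ^ 2)) * z ^ 2 := by
    funext z; unfold psiPCF; ring
  rw [e]
  exact (so_hasDerivAt_quad _ _ Z).congr_deriv (by ring)

/-! ## Mixed second derivative -/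

/-- `Ψ_RZ = ∂_Z Ψ_R = −16 d₃ R Z` for the PCF solution. [cite: PatakiCerfonFreidberg2013, §6.1] -/
theorem dRZ_psiPCF (d₁ d₂ d₃ R Z : ℝ) : dRZ (psiPCF d₁ d₂ d₃) R Z = -(16 * d₃ * R * Z) := by
  unfold dRZ
  rw [show (fun z => dR (psiPCF d₁ d₂ d₃) R z)
      = fun z => (R ^ 3 / 2 + 2 * d₂ * R + 4 * d₃ * R ^ 3) + (-(8 * d₃ * R)) * z ^ 2 from
    funext fun z => by rw [dR_psiPCF]; ring]
  rw [(so_hasDerivAt_quad _ _ Z).deriv]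
  ring

/-- `Ψ_ZR = ∂_R Ψ_Z = −16 d₃ R Z` (equal to `Ψ_RZ`, as it must). [cite: PatakiCerfonFreidberg2013, §6.1] -/
theorem dZR_psiPCF (d₁ d₂ d₃ R Z : ℝ) : dZR (psiPCF d₁ d₂ d₃) R Z = -(16 * d₃ * R * Z) := by
  unfold dZR
  rw [show (fun r => dZ (psiPCF d₁ d₂ d₃) r Z) = fun r => 0 + (-(8 * d₃ * Z)) * r ^ 2 from
    funext fun r => by rw [dZ_psiPCF]; ring]
  rw [(so_hasDerivAt_quad _ _ R).deriv]
  ring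

/-! ## `|∇Ψ|²` and its gradient -/

/-- `|∇Ψ|² = Ψ_R² + Ψ_Z²` of the PCF solution, explicit polynomial. [cite: PatakiCerfonFreidberg2013, §6.1] -/
theorem gradSq_psiPCF (d₁ d₂ d₃ R Z : ℝ) :
    gradSq (psiPCF d₁ d₂ d₃) R Z
      = (R ^ 3 / 2 + 2 * d₂ * R + d₃ * (4 * R ^ 3 - 8 * R * Z ^ 2)) ^ 2 + (8 * d₃ * R ^ 2 * Z) ^ 2 := by
  unfold gradSq
  rw [dR_psiPCF, dZ_psiPCF]
  ring

/-- `r ↦ |∇Ψ|²(r, Z)` has derivative `2Ψ_RΨ_RR + 2Ψ_ZΨ_ZR` (explicit). [cite: PatakiCerfonFreidberg2013, §6.1] -/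
theorem hasDerivAt_gradSq_psiPCF_R (d₁ d₂ d₃ R Z : ℝ) :
    HasDerivAt (fun r => gradSq (psiPCF d₁ d₂ d₃) r Z)
      (2 * (R ^ 3 / 2 + 2 * d₂ * R + d₃ * (4 * R ^ 3 - 8 * R * Z ^ 2))
          * (3 * R ^ 2 / 2 + 2 * d₂ + d₃ * (12 * R ^ 2 - 8 * Z ^ 2))
        + 2 * (8 * d₃ * R ^ 2 * Z) * (16 * d₃ * R * Z)) R := by
  have hp := so_hasDerivAt_cubic (2 * d₂ - 8 * d₃ * Z ^ 2) (1 / 2 + 4 * d₃) R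
  have hq := (hasDerivAt_pow 2 R).const_mul (8 * d₃ * Z)
  have h := (hp.mul hp).add (hq.mul hq)
  have e : (fun r => gradSq (psiPCF d₁ d₂ d₃) r Z)
      = fun r => ((2 * d₂ - 8 * d₃ * Z ^ 2) * r + (1 / 2 + 4 * d₃) * r ^ 3)
          * ((2 * d₂ - 8 * d₃ * Z ^ 2) * r + (1 / 2 + 4 * d₃) * r ^ 3)
        + (8 * d₃ * Z * r ^ 2) * (8 * d₃ * Z * r ^ 2) := by
    funext r; rw [gradSq_psiPCF]; ring
  rw [e]
  exact h.congr_deriv (by norm_num; ring)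

/-- `∂_R |∇Ψ|² = 2Ψ_RΨ_RR + 2Ψ_ZΨ_ZR` for the PCF solution (in the tree's `dR`/`dRR`/`dZ`/`dZR` vocabulary).
[cite: PatakiCerfonFreidberg2013, §6.1] -/
theorem dR_gradSq_psiPCF (d₁ d₂ d₃ R Z : ℝ) :
    dR (gradSq (psiPCF d₁ d₂ d₃)) R Z
      = 2 * dR (psiPCF d₁ d₂ d₃) R Z * dRR (psiPCF d₁ d₂ d₃) R Z
        + 2 * dZ (psiPCF d₁ d₂ d₃) R Z * dZR (psiPCF d₁ d₂ d₃) R Z := by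
  unfold dR
  rw [(hasDerivAt_gradSq_psiPCF_R d₁ d₂ d₃ R Z).deriv]
  rw [show deriv (fun r => psiPCF d₁ d₂ d₃ r Z) R = dR (psiPCF d₁ d₂ d₃) R Z from rfl, dR_psiPCF,
    dRR_psiPCF, dZ_psiPCF, dZR_psiPCF]
  ring

/-- `z ↦ |∇Ψ|²(R, z)` has derivative `2Ψ_RΨ_RZ + 2Ψ_ZΨ_ZZ` (explicit). [cite: PatakiCerfonFreidberg2013, §6.1] -/
theorem hasDerivAt_gradSq_psiPCF_Z (d₁ d₂ d₃ R Z : ℝ) :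
    HasDerivAt (fun z => gradSq (psiPCF d₁ d₂ d₃) R z)
      (2 * (R ^ 3 / 2 + 2 * d₂ * R + d₃ * (4 * R ^ 3 - 8 * R * Z ^ 2)) * (-(16 * d₃ * R * Z))
        + 2 * (8 * d₃ * R ^ 2 * Z) * (8 * d₃ * R ^ 2)) Z := by
  have hp := so_hasDerivAt_quad (R ^ 3 / 2 + 2 * d₂ * R + 4 * d₃ * R ^ 3) (-(8 * d₃ * R)) Z
  have hq := (hasDerivAt_id' Z).const_mul (8 * d₃ * R ^ 2)
  have h := (hp.mul hp).add (hq.mul hq)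
  have e : (fun z => gradSq (psiPCF d₁ d₂ d₃) R z)
      = fun z => (R ^ 3 / 2 + 2 * d₂ * R + 4 * d₃ * R ^ 3 + -(8 * d₃ * R) * z ^ 2)
          * (R ^ 3 / 2 + 2 * d₂ * R + 4 * d₃ * R ^ 3 + -(8 * d₃ * R) * z ^ 2)
        + (8 * d₃ * R ^ 2 * z) * (8 * d₃ * R ^ 2 * z) := by
    funext z; rw [gradSq_psiPCF]; ring
  rw [e]
  exact h.congr_deriv (by ring)

/-- `∂_Z |∇Ψ|² = 2Ψ_RΨ_RZ + 2Ψ_ZΨ_ZZ` for the PCF solution. [cite: PatakiCerfonFreidberg2013, §6.1] -/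
theorem dZ_gradSq_psiPCF (d₁ d₂ d₃ R Z : ℝ) :
    dZ (gradSq (psiPCF d₁ d₂ d₃)) R Z
      = 2 * dR (psiPCF d₁ d₂ d₃) R Z * dRZ (psiPCF d₁ d₂ d₃) R Z
        + 2 * dZ (psiPCF d₁ d₂ d₃) R Z * dZZ (psiPCF d₁ d₂ d₃) R Z := by
  unfold dZ
  rw [(hasDerivAt_gradSq_psiPCF_Z d₁ d₂ d₃ R Z).deriv]
  rw [show deriv (psiPCF d₁ d₂ d₃ R) Z = dZ (psiPCF d₁ d₂ d₃) R Z from rfl, dR_psiPCF, dZ_psiPCF,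
    dRZ_psiPCF, dZZ_psiPCF]
  ring


/-! ## `B²` for the constant free function `F` (Solov'ev `FF′ = 0`) and its gradient -/

/-- `r ↦ B²(r, Z) = (F² + |∇Ψ|²)/r²` (constant `F`, PCF `Ψ`) has derivative
`(∂_R|∇Ψ|²)/R² − 2(F² + |∇Ψ|²)/R³` at `R ≠ 0`. [cite: Freidberg2014, §12.3 eq. (12.39)] -/
theorem hasDerivAt_fieldBsq_psiPCF_R (F d₁ d₂ d₃ Z : ℝ) {R : ℝ} (hR : R ≠ 0) :
    HasDerivAt (fun r => fieldBsq (fun _ => F) (psiPCF d₁ d₂ d₃) r Z)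
      (dR (gradSq (psiPCF d₁ d₂ d₃)) R Z / R ^ 2
        - 2 * (F ^ 2 + gradSq (psiPCF d₁ d₂ d₃) R Z) / R ^ 3) R := by
  have hev : (fun r => (F ^ 2 + gradSq (psiPCF d₁ d₂ d₃) r Z) / r ^ 2)
      =ᶠ[nhds R] fun r => fieldBsq (fun _ => F) (psiPCF d₁ d₂ d₃) r Z := by
    filter_upwards [isOpen_ne.mem_nhds hR] with r hr
    exact (fieldBsq_const _ Z hr).symm
  have hG : HasDerivAt (fun r => gradSq (psiPCF d₁ d₂ d₃) r Z) (dR (gradSq (psiPCF d₁ d₂ d₃)) R Z) R :=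
    (hasDerivAt_gradSq_psiPCF_R d₁ d₂ d₃ R Z).differentiableAt.hasDerivAt
  have h := (hG.const_add (F ^ 2)).div (hasDerivAt_pow 2 R) (pow_ne_zero 2 hR)
  refine (h.congr_of_eventuallyEq hev.symm).congr_deriv ?_
  -- note: `congr_of_eventuallyEq` wants `f₁ =ᶠ f`; orientation fixed by `hev.symm`
  field_simp
  ring

/-- `∂_R B² = (∂_R|∇Ψ|²)/R² − 2(F² + |∇Ψ|²)/R³` (constant `F`, PCF `Ψ`, `R ≠ 0`).
[cite: Freidberg2014, §12.3 eq. (12.39)] -/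
theorem dR_fieldBsq_psiPCF (F d₁ d₂ d₃ Z : ℝ) {R : ℝ} (hR : R ≠ 0) :
    dR (fieldBsq (fun _ => F) (psiPCF d₁ d₂ d₃)) R Z
      = dR (gradSq (psiPCF d₁ d₂ d₃)) R Z / R ^ 2 - 2 * (F ^ 2 + gradSq (psiPCF d₁ d₂ d₃) R Z) / R ^ 3 :=
  (hasDerivAt_fieldBsq_psiPCF_R F d₁ d₂ d₃ Z hR).deriv

/-- `z ↦ B²(R, z)` (constant `F`, PCF `Ψ`, `R ≠ 0`) has derivative `(∂_Z|∇Ψ|²)/R²`.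
[cite: Freidberg2014, §12.3 eq. (12.39)] -/
theorem hasDerivAt_fieldBsq_psiPCF_Z (F d₁ d₂ d₃ Z : ℝ) {R : ℝ} (hR : R ≠ 0) :
    HasDerivAt (fun z => fieldBsq (fun _ => F) (psiPCF d₁ d₂ d₃) R z)
      (dZ (gradSq (psiPCF d₁ d₂ d₃)) R Z / R ^ 2) Z := by
  have e : (fun z => fieldBsq (fun _ => F) (psiPCF d₁ d₂ d₃) R z)
      = fun z => (F ^ 2 + gradSq (psiPCF d₁ d₂ d₃) R z) / R ^ 2 :=
    funext fun z => fieldBsq_const _ z hR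
  rw [e]
  have hG : HasDerivAt (fun z => gradSq (psiPCF d₁ d₂ d₃) R z) (dZ (gradSq (psiPCF d₁ d₂ d₃)) R Z) Z :=
    (hasDerivAt_gradSq_psiPCF_Z d₁ d₂ d₃ R Z).differentiableAt.hasDerivAt
  exact (hG.const_add (F ^ 2)).div_const (R ^ 2)

/-- `∂_Z B² = (∂_Z|∇Ψ|²)/R²` (constant `F`, PCF `Ψ`, `R ≠ 0`). [cite: Freidberg2014, §12.3 eq. (12.39)] -/
theorem dZ_fieldBsq_psiPCF (F d₁ d₂ d₃ Z : ℝ) {R : ℝ} (hR : R ≠ 0) :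
    dZ (fieldBsq (fun _ => F) (psiPCF d₁ d₂ d₃)) R Z = dZ (gradSq (psiPCF d₁ d₂ d₃)) R Z / R ^ 2 :=
  (hasDerivAt_fieldBsq_psiPCF_Z F d₁ d₂ d₃ Z hR).deriv

/-! ## The normal curvature `κ_n` (12.39) on the PCF equilibrium in closed form

For the Solov'ev profiles of the PCF solution — pressure LINEAR in `Ψ` with `μ₀ dp/dΨ = −1`
(`p(s) = p₀ − s/μ₀`) and constant `F` — Freidberg's `κ_n = (μ₀RB_p/B²) ∂_ψ(p + B²/2μ₀)` with
`∂_ψ f = ∇Ψ·∇f/|∇Ψ|²` (`FluxGeometry.dPsi`) reduces to first/second derivatives of `Ψ` only: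
`κ_n = (R B_p/B²)·(−1 + ∇Ψ·∇B²/(2|∇Ψ|²))` — and `∇B²` is given above. -/

/-- **`κ_n` of the PCF equilibrium, closed form:** with `p(s) = p₀ − s/μ₀`, constant `F`, at a point with
`R ≠ 0` and `∇Ψ ≠ 0`:
`normalCurvature μ₀ p F Ψ R Z = (R B_p/B²) · (−1 + (Ψ_R ∂_RB² + Ψ_Z ∂_ZB²)/(2|∇Ψ|²))`.
[cite: Freidberg2014, §12.3 eq. (12.39)] -/
theorem normalCurvature_psiPCF {μ0 R : ℝ} (p₀ F d₁ d₂ d₃ Z : ℝ) (hμ : μ0 ≠ 0) (hR : R ≠ 0)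
    (hg : gradSq (psiPCF d₁ d₂ d₃) R Z ≠ 0) :
    normalCurvature μ0 (fun s => p₀ - s / μ0) (fun _ => F) (psiPCF d₁ d₂ d₃) R Z
      = R * fieldBpol (psiPCF d₁ d₂ d₃) R Z / fieldBsq (fun _ => F) (psiPCF d₁ d₂ d₃) R Z
        * (-1 + gradDot (psiPCF d₁ d₂ d₃) (fieldBsq (fun _ => F) (psiPCF d₁ d₂ d₃)) R Z
            / (2 * gradSq (psiPCF d₁ d₂ d₃) R Z)) := by
  have h1 := hasDerivAt_psiPCF_R d₁ d₂ d₃ R Z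
  have h2 := hasDerivAt_fieldBsq_psiPCF_R F d₁ d₂ d₃ Z hR
  have h3 := hasDerivAt_psiPCF_Z d₁ d₂ d₃ R Z
  have h4 := hasDerivAt_fieldBsq_psiPCF_Z F d₁ d₂ d₃ Z hR
  have hfR : dR (fun r z => (fun s => p₀ - s / μ0) (psiPCF d₁ d₂ d₃ r z)
        + fieldBsq (fun _ => F) (psiPCF d₁ d₂ d₃) r z / (2 * μ0)) R Z
      = -(dR (psiPCF d₁ d₂ d₃) R Z / μ0)
        + (dR (gradSq (psiPCF d₁ d₂ d₃)) R Z / R ^ 2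
            - 2 * (F ^ 2 + gradSq (psiPCF d₁ d₂ d₃) R Z) / R ^ 3) / (2 * μ0) :=
    (((h1.div_const μ0).const_sub p₀).fun_add (h2.div_const (2 * μ0))).deriv
  have hfZ : dZ (fun r z => (fun s => p₀ - s / μ0) (psiPCF d₁ d₂ d₃ r z)
        + fieldBsq (fun _ => F) (psiPCF d₁ d₂ d₃) r z / (2 * μ0)) R Z
      = -(dZ (psiPCF d₁ d₂ d₃) R Z / μ0) + dZ (gradSq (psiPCF d₁ d₂ d₃)) R Z / R ^ 2 / (2 * μ0) :=
    (((h3.div_const μ0).const_sub p₀).fun_add (h4.div_const (2 * μ0))).deriv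
  unfold normalCurvature dPsi gradDot
  rw [hfR, hfZ, dR_fieldBsq_psiPCF F d₁ d₂ d₃ Z hR, dZ_fieldBsq_psiPCF F d₁ d₂ d₃ Z hR]
  have hg' : dR (psiPCF d₁ d₂ d₃) R Z ^ 2 + dZ (psiPCF d₁ d₂ d₃) R Z ^ 2 ≠ 0 := by
    unfold gradSq at hg; exact hg
  unfold gradSq
  field_simp
  ring

end Literature.MathematicalPhysics.MHD.Solovev
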